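import Summits.MatrixMultiplication.MatrixMultiplication.Theses.HiddenToeplitzCorners
import Summits.MatrixMultiplication.MatrixMultiplication.Theorems.HiddenToeplitzCornersHiddenCornerLemmaRRelVis
import Summits.MatrixMultiplication.MatrixMultiplication.Theorems.HiddenToeplitzCornersHiddenCornerLemmaRGConstD1
import Summits.MatrixMultiplication.MatrixMultiplication.Theorems.HiddenToeplitzCornersHiddenCornerLemmaRHConst
import Summits.MatrixMultiplication.MatrixMultiplication.Theorems.HiddenToeplitzCornersHiddenCornerLemmaRStubNormalFormGlue
import Summits.MatrixMultiplication.MatrixMultiplication.Theorems.HiddenToeplitzCornersHiddenCornerLemmaRStubCoreSplit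
import Summits.MatrixMultiplication.MatrixMultiplication.Theorems.HiddenToeplitzCornersHiddenCornerLemmaRStubPrimitiveBound
import Summits.MatrixMultiplication.MatrixMultiplication.Theorems.HiddenToeplitzCornersHiddenCornerLemmaRStubALReduction
import Summits.MatrixMultiplication.MatrixMultiplication.Theorems.HiddenToeplitzCornersHiddenCornerLemmaRStubDualityAnnihilator
import Summits.MatrixMultiplication.MatrixMultiplication.Theorems.HiddenToeplitzCornersHiddenCornerLemmaRPhiInjGeneral

/-!
# Line `atkinson-lloyd-core-split` for crux `HiddenCornerLemmaR` (stmt-MatrixMultiplication-10752) — skeleton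

LEAD c1 (prover-line-stmt-MatrixMultiplication-10752-c1-0, 2026-08-16), reshape v2: the planner's
literature stub `stub_normalForm` is split into three registered stubs — `stub_alReduction`
(Atkinson–Lloyd 1981 Thm 1 part 1: border rows/columns + PRIMITIVE core, primitivity spelled
out as four explicit conditions), `stub_primitiveBound` (Thm 1 part 2: a primitive space of upper
rank ρ has ≤ ρ(ρ+1)/2 rows and columns) and `stub_normalFormGlue` (bookkeeping) — and
`al_normalForm` is DERIVED from them; everything below the stubs is the planner's sorry-free glue,
unchanged.  Registered stubs: stub_alReduction (LANDED p125974, imported), stub_primitiveBound (LANDED p125502, imported), stub_normalFormGlue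
(LANDED p125010, imported), stub_coreSplit (LANDED p125343, imported), stub_gconstDualLaw (hardest, the
lead's; stub_leftConstBound is DERIVED from it via the landed S2; reduction to PHI-INJ(p) landed p125498),
stub_mixedDeepBound, stub_coreClassBound.

Crux (route `HiddenToeplitzCorners`, negative side, r5): a linear pencil `T(X) = Σ X a b • T a b` of
`N × N` complex matrices hiding a linearly explained corner `T(X) E = F X` (`rank E = rank F = r`),
of Stein displacement rank `rank (T(X) − Z T(X) Zᵀ) ≤ d` for every `X` (`Z` = lower shift) and
generically nonsingular, has `r ≤ 2d`.

Idea card `Ideas/atkinson-lloyd-core-split.md` (ideator 2; triage r1 ×2: pass, merge-flag with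
`compression-normal-form`, whose sharpenings are adopted below). The LEVER: the displacement space
`𝒟 = {T(X) − Z T(X) Zᵀ}` is a linear space of `N × N` matrices of upper rank `≤ d`; the
Atkinson–Lloyd reduction (AtkinsonLloyd1981 Thm 1: delete common-kernel columns / cokernel rows, peel
bordering rows / columns, until the residue is PRIMITIVE) together with Atkinson's theorem
(Atkinson1983 Thm B; de Seguins Pazzis arXiv:1211.5118 p.5 Thm 1, page-checked: a semi-primitive
space of upper rank `ρ` over a field with `> ρ` elements has `≤ ρ(ρ+1)/2` rows, and dually columns)
puts `𝒟`, up to a CONSTANT equivalence `(P, Q)`, inside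
`{p border rows} + {q border columns} + {an m₀ × n₀ core of upper rank ρ}` with `p + q + ρ ≤ d`
and `m₀, n₀ ≤ ρ(ρ+1)/2` — independently of `N` (`stub_normalForm`, a theorem of the literature).
Undoing the equivalence (`stub_coreSplit`, provable now) every pencil of the crux acquires CONSTANT
OUTER FACTORS:
  `T a b − Z (T a b) Zᵀ = G₀ (H₁ a b)ᵀ + (G₁ a b) H₀ᵀ + Γ (C a b) Θᵀ`,
`G₀ : N × p`, `H₀ : N × q`, `Γ : N × m₀`, `Θ : N × n₀` constant of full column rank, `rank C(X) ≤ ρ`.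
So HCL-R reduces to the generalised split class WITH A RANK BUDGET (the card's transfer C⁺), which the
skeleton cuts along the three structurally different regimes named by the lead's assessment
(crux NOTES.md §9: "(ii) G-const bound, (iii) mixed classes below the G-cut, (iv) cores"):
* `stub_leftConstBound` — pure left-constant class (`q = 0`, no core): `r ≤ 2p`.  The HARDEST stub:
  first open instance `(p, r) = (2, 4)`; the W-family shows `r = 2p − 1` is attained for every `p`
  (witnesses W1 `(3,9,2)`, W2 `(5,25,3)` attached to the item, `(7,49,4)` in the lead's notes E2),
  so the stub is tight to within one.
* `stub_mixedDeepBound` — mixed class (`q ≥ 1`, no core) in the DEEP branch: every target column of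
  `F` vanishes above every cut above which `G₀` vanishes: `r ≤ 2(p+q)`.  (The VISIBLE branch —
  a target entry above the G-cut — is `r ≤ q`, the landed relative H-constant lemma
  `hclR_relvis_bound`, p108204, used verbatim in the glue.)
* `stub_coreClassBound` — a primitive core is present (`m₀, n₀ ≥ 1`, hence `ρ ≥ 2` in truth), deep
  branch w.r.t. the combined left factor `[G₀ | Γ]`: `r ≤ 2(p+q+ρ)`; Atkinson's bound makes this a
  finite-type problem per `ρ` (`d = 3`: cores have `≤ 6` rows/columns; a pure core is priced
  `r ≤ n₀ ≤ 6 = 2d` by `hclR_hconst_bound` already).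
Each class stub concludes the WEAKEST inequality the assembly needs (`2 ×` its own rank budget), so
each is IMPLIED by the crux (certificates `leftConstBound_of_hclR`, `mixedDeepBound_of_hclR`,
`coreClassBound_of_hclR`, sorry-free below): given the two reduction stubs the skeleton is an
EQUIVALENCE `crux ⟺ stub₃ ∧ stub₄ ∧ stub₅` — nothing false is chased, nothing is lost — and the
sharper conjectural values (`2p − 1`, `2p − 1 + q`, cores at `ρ`) are recorded in the line card only.
Two partial discharges are machine-checked as well: `leftConstBound_p_one` (stub 3 at `p = 1`, by
the landed `hclR_gconst_d_one`) and `coreClassBound_p_zero_small` (stub 5 with `p = 0`, `ρ ≤ 3`, by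
the landed `hclR_hconst_bound` + Atkinson's bound) — so at `d = 2` the only open MATHEMATICAL content
of the line is stub 3 at `p = 2` (`r ≤ 4`) and stub 4 at `(p,q) = (1,1)` (`r ≤ 4`); stubs 1–2 are
formalisation work (a published theorem and its bookkeeping).

Glue PROVED here (no sorry): `bound_noCore` (visible/deep dichotomy via `hclR_relvis_bound`, then
`q = 0` ↦ stub 3, `q ≥ 1` ↦ stub 4), `bound_core` (the core term is absorbed into the left factor
`[G₀ | Γ]` reindexed to `Fin (p + m₀)` for the visible branch; deep branch ↦ stub 5),
`of_parts : stub₁ → (stub₁ → stub₂) → stub₃ → stub₄ → stub₅ → (crux unfolded)`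
(the sorry-free composition; an empty core `m₀ = 0 ∨ n₀ = 0` kills the core term) and
`HiddenCornerLemmaR_of : HiddenCornerLemmaR := of_parts stub_normalForm … stub_coreClassBound`
(the ONLY theorem concluding the route decl BY NAME; `sorry` occurs only inside the five `stub_*`).

Disproof used: NO `Disproof.lean` exists for this crux at write time (payload `disproof_path` absent
on disk; `ledger crux ls` lists none), so there is no `_false_without_` theorem to honour formally.
The recorded obstructions are honoured as follows: (a) refuted predecessor stmt-7493 (`(r,N,d) =
(3,9,1)`, `det T ≡ 0`): every class stub carries `∃ X₀, det T(X₀) ≠ 0`, and it is consumed exactly in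
the left-constant analysis (graded singular configurations have unbounded `r`); (b) the two dead
transfers of round 1 — `ImageFrameDefect` (α_F ≤ d; exact witnesses `(13,3,2)`, `(9,3,2)` with
α_F = 3) and `HCLRDiag` (circulant projections, `r = N`) — are not stubs here and no stub implies
either: the class stubs quantify over the full pencil (all `T a b`, off-diagonal included) and never
over a frame defect; (c) tightness `r = 2d − 1` (W-family): no stub claims better than `2 ×` budget.
Negatives index (`ledger negatives --problem MatrixMultiplication`): only stmt-7493 bears on this
crux; no stub is an instance of it (all carry nonsingularity).
-/

set_option linter.dupNamespace false

namespace Summit.MatrixMultiplication.MatrixMultiplication.Cruxes.HiddenCornerLemmaR.AtkinsonLloydCoreSplit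

open Matrix
open Summit.MatrixMultiplication.MatrixMultiplication.Theorems (hclR_relvis_bound hclR_gconst_d_one
  hclR_hconst_bound)
open Summit.MatrixMultiplication.MatrixMultiplication.Theses.HiddenToeplitzCorners (HiddenCornerLemmaR)
open Summit.MatrixMultiplication.MatrixMultiplication.Cruxes.HiddenCornerLemmaR.FrobeniusDualShortSyzygies
  (stub_dualityAnnihilator)

/-! ## Registered stubs

Notation in the docstrings: `Z` = the lower shift `Z i j = [i = j + 1]` on `ℂ^N`
(written out as `Matrix.of …` in every signature), `∇M := M − Z M Zᵀ` (Stein displacement),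
`T(X) := Σ X a b • T a b`; "corner" = `T(X) E = F X` for all `X`; "nonsingular" = `∃ X₀, det T(X₀) ≠ 0`.
Every signature is self-contained over Mathlib + the route file (no local definitions), so that a
`propose --supports stmt-MatrixMultiplication-10752` file can restate it verbatim. -/

/-- **`al_normalForm` (the former stub 1, now DERIVED from stubs 1a–1c)**: Atkinson–Lloyd normal form with the size bound (a THEOREM
of the literature, to be formalised or vendored: AtkinsonLloyd1981 = doi:10.1017/s144678870001795x,
Thm 1 + Lemma 6; Atkinson1983 = doi:10.1017/s1446788700023740, Thm B; both restated and page-checked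
as de Seguins Pazzis 2013, arXiv:1211.5118 = doi:10.1093/qmath/hat029, §2 (definition of primitive /
semi-primitive, conditions (i)–(iv), p. 4) and Thm 1 (p. 5): a semi-primitive subspace of
`M_{m,n}(K)` of upper rank `r` with `#K > r` has `m ≤ r(r+1)/2`; transpose for columns).
Statement: every linear subspace `V` of `m × n` complex matrices all of rank `≤ d` is, after a
constant equivalence `M ↦ P M Q` (`P, Q` invertible), supported on
`(border rows BR) × all ∪ all × (border columns BC) ∪ (core rows CR) × (core columns CC)` with
`#BR + #BC + ρ ≤ d`, `#CR, #CC ≤ ρ(ρ+1)/2`, `BR ∩ CR = ∅ = BC ∩ CC`, and the core block (the matrix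
with border rows and columns blanked) of rank `≤ ρ` throughout `V`.
Proof in print: induct on `m + n` along the four moves — (i) a common kernel vector gives a zero
column, (ii) a common cokernel vector a zero row (neither changes the upper rank), (iii)/(iv) a
bordering column/row whose deletion LOWERS the upper rank is peeled into BC/BR (upper rank drops by
≥ 1 each time); the terminal residue satisfies (i)–(iv), i.e. is primitive of upper rank
`ρ ≤ urk V − #BR − #BC`, and Atkinson's theorem bounds its rows and (transposed) columns by
`ρ(ρ+1)/2` (`ρ = 0`: the residue is the zero space on a `0 × 0` window). The possibly non-zero
entries of a zero row (column) created at a later stage lie in border columns (rows) peeled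
earlier, which gives exactly the displayed support.
Why it might fail: only by mis-transcription (it is Atkinson–Lloyd–Atkinson verbatim over `ℂ`,
`#ℂ > ρ`); the degenerate cases `m = 0`, `n = 0`, `V = 0`, `V = ⊤` were checked by hand.
Size: L–XL to formalise (the reduction is an elementary induction; Atkinson's Thm B is four pages of
linear algebra over an infinite field); vendorable meanwhile as a cited Literature fact
`Literature.Algebra.LinearAlgebra.BoundedRankSpaces.atkinsonLloydNormalForm` (definition request in
the line card). -/
theorem al_normalForm :
    ∀ (m n d : ℕ) (V : Submodule ℂ (Matrix (Fin m) (Fin n) ℂ)), (∀ M ∈ V, M.rank ≤ d) →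
    ∃ (P : Matrix (Fin m) (Fin m) ℂ) (Q : Matrix (Fin n) (Fin n) ℂ), IsUnit P ∧ IsUnit Q ∧
      ∃ (BR CR : Finset (Fin m)) (BC CC : Finset (Fin n)) (ρ : ℕ),
        Disjoint BR CR ∧ Disjoint BC CC ∧ BR.card + BC.card + ρ ≤ d ∧
        2 * CR.card ≤ ρ * (ρ + 1) ∧ 2 * CC.card ≤ ρ * (ρ + 1) ∧
        (∀ M ∈ V, ∀ (i : Fin m) (j : Fin n), (P * M * Q) i j ≠ 0 →
          i ∈ BR ∨ j ∈ BC ∨ (i ∈ CR ∧ j ∈ CC)) ∧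
        (∀ M ∈ V, (Matrix.of fun (i : Fin m) (j : Fin n) =>
          if i ∈ BR ∨ j ∈ BC then (0 : ℂ) else (P * M * Q) i j).rank ≤ ρ) :=
  stub_normalFormGlue stub_alReduction stub_primitiveBound

/-- **stub 3' — `stub_gconstDualLaw` (registered 2026-08-16 by lead a1 from the sibling line; adopted here
as THE G-constant stub): the dual G-constant law.**  Data: constant generators `G₀ : N × p`, a frame
`E` and a target frame `F` of rank `r` such that `F` is killed by the explicit annihilator of the
corner map (S2 = the LANDED `stub_dualityAnnihilator`, p112087), and ONE matrix `M` of the class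
(`∇M = G₀ Hᵀ`) which is invertible and maps the frame into the targets (`M E = F X₀`); conclusion
`r ≤ 2p`.  Equivalent to the primal law `stub_leftConstBound` below (derived from it through S2), hence
implied by the crux; tight to within one (W-family `r = 2p − 1`).  LANDED towards it: `p ≤ 1`
(p121402), strip generators `r ≤ 2p − 1` (p121072), and the reduction to kernel triviality
`hclR_gconstDualLaw_of_phiInj` (p125498, all `p`): PHI-INJ(p) — "in a nonsingular `(2p−1)`-column
design a class member killing the frame kills its Krylov span" — implies this stub (indeed `r ≤ 2p−1`).
Why it might fail: only if the crux fails inside the G-constant class (a nonsingular `(2p, p)` design). -/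
theorem stub_gconstDualLaw :
    ∀ (r N p : ℕ) (G₀ : Matrix (Fin N) (Fin p) ℂ) (E F : Matrix (Fin N) (Fin r) ℂ)
      (M : Matrix (Fin N) (Fin N) ℂ) (H : Matrix (Fin N) (Fin p) ℂ) (X₀ : Matrix (Fin r) (Fin r) ℂ),
      E.rank = r → F.rank = r →
      (∀ Λ : Matrix (Fin N) (Fin r) ℂ,
        (∀ k : Fin p,
          (∑ c : Fin r,
            (∑ j : Fin N,
              (((∑ i : Fin N, G₀ i k •
                  (Matrix.of fun i j : Fin N => if (i : ℕ) = (j : ℕ) + 1 then (1 : ℂ) else 0)ᵀ ^ (i : ℕ))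
                *ᵥ (Λᵀ c)) j) •
              (Matrix.of fun i j : Fin N => if (i : ℕ) = (j : ℕ) + 1 then (1 : ℂ) else 0)ᵀ ^ (j : ℕ))
            *ᵥ (Eᵀ c)) = 0) →
        Λᵀ * F = 0) →
      M - (Matrix.of fun i j : Fin N => if (i : ℕ) = (j : ℕ) + 1 then (1 : ℂ) else 0) * M *
          (Matrix.of fun i j : Fin N => if (i : ℕ) = (j : ℕ) + 1 then (1 : ℂ) else 0)ᵀ = G₀ * Hᵀ →
      M * E = F * X₀ →
      M.det ≠ 0 →
      r ≤ 2 * p := by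
  sorry

/-- Displacement is linear (glue): if every coefficient has `∇(T a b) = G₀ (H₁ a b)ᵀ`, then
`∇T(X) = G₀ (Σ X_ab • H₁ a b)ᵀ`. -/
theorem disp_eval_gconst {r N p : ℕ} (T : Fin r → Fin r → Matrix (Fin N) (Fin N) ℂ)
    (G₀ : Matrix (Fin N) (Fin p) ℂ) (H₁ : Fin r → Fin r → Matrix (Fin N) (Fin p) ℂ)
    (hdisp : ∀ a b, T a b - (Matrix.of fun i j : Fin N => if (i : ℕ) = (j : ℕ) + 1 then (1 : ℂ) else 0) * T a b *
        (Matrix.of fun i j : Fin N => if (i : ℕ) = (j : ℕ) + 1 then (1 : ℂ) else 0)ᵀ = G₀ * (H₁ a b)ᵀ)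
    (X : Matrix (Fin r) (Fin r) ℂ) :
    (∑ a : Fin r, ∑ b : Fin r, X a b • T a b) -
        (Matrix.of fun i j : Fin N => if (i : ℕ) = (j : ℕ) + 1 then (1 : ℂ) else 0) *
          (∑ a : Fin r, ∑ b : Fin r, X a b • T a b) *
          (Matrix.of fun i j : Fin N => if (i : ℕ) = (j : ℕ) + 1 then (1 : ℂ) else 0)ᵀ
      = G₀ * (∑ a : Fin r, ∑ b : Fin r, X a b • H₁ a b)ᵀ := by
  set Z : Matrix (Fin N) (Fin N) ℂ :=
    Matrix.of fun i j : Fin N => if (i : ℕ) = (j : ℕ) + 1 then (1 : ℂ) else 0 with hZ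
  have e1 : Z * (∑ a : Fin r, ∑ b : Fin r, X a b • T a b) * Zᵀ =
      ∑ a : Fin r, ∑ b : Fin r, X a b • (Z * T a b * Zᵀ) := by
    simp only [Matrix.mul_sum, Matrix.sum_mul, Matrix.mul_smul, Matrix.smul_mul]
  have e2 : G₀ * (∑ a : Fin r, ∑ b : Fin r, X a b • H₁ a b)ᵀ =
      ∑ a : Fin r, ∑ b : Fin r, X a b • (G₀ * (H₁ a b)ᵀ) := by
    simp only [Matrix.transpose_sum, Matrix.transpose_smul, Matrix.mul_sum, Matrix.mul_smul]
  rw [e1, e2, ← Finset.sum_sub_distrib]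
  refine Finset.sum_congr rfl fun a _ => ?_
  rw [← Finset.sum_sub_distrib]
  refine Finset.sum_congr rfl fun b _ => ?_
  rw [← smul_sub, hdisp a b]

/-- **`stub_leftConstBound` (the planner's stub 3, now DERIVED): the pure left-constant (G-constant)
class, `r ≤ 2p`** — from the landed duality `stub_dualityAnnihilator` (S2: a G-constant corner family
forces `Λᵀ F = 0` for every test matrix in the explicit annihilator) and the registered dual law
`stub_gconstDualLaw` applied to the nonsingular member `M := T(X₀)` (glue `disp_eval_gconst`).
(`G₀.rank = p` is not needed.) -/
theorem stub_leftConstBound :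
    ∀ (r N p : ℕ) (T : Fin r → Fin r → Matrix (Fin N) (Fin N) ℂ) (E F : Matrix (Fin N) (Fin r) ℂ)
    (G₀ : Matrix (Fin N) (Fin p) ℂ) (H₁ : Fin r → Fin r → Matrix (Fin N) (Fin p) ℂ),
    E.rank = r → F.rank = r → G₀.rank = p →
    (∀ X : Matrix (Fin r) (Fin r) ℂ, (∑ a : Fin r, ∑ b : Fin r, X a b • T a b) * E = F * X) →
    (∀ a b, T a b - (Matrix.of fun i j : Fin N => if (i : ℕ) = (j : ℕ) + 1 then (1 : ℂ) else 0) * T a b * (Matrix.of fun i j : Fin N => if (i : ℕ) = (j : ℕ) + 1 then (1 : ℂ) else 0)ᵀ = G₀ * (H₁ a b)ᵀ) →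
    (∃ X₀ : Matrix (Fin r) (Fin r) ℂ, (∑ a : Fin r, ∑ b : Fin r, X₀ a b • T a b).det ≠ 0) →
    r ≤ 2 * p := by
  intro r N p T E F G₀ H₁ hE hF _hG₀ hcorner hdisp hns
  obtain ⟨X₀, hX₀⟩ := hns
  have horth := stub_dualityAnnihilator r N p T E F G₀ H₁ hcorner hdisp
  have hM := disp_eval_gconst T G₀ H₁ hdisp X₀
  exact stub_gconstDualLaw r N p G₀ E F (∑ a : Fin r, ∑ b : Fin r, X₀ a b • T a b)
    (∑ a : Fin r, ∑ b : Fin r, X₀ a b • H₁ a b) X₀ hE hF horth hM (hcorner X₀) hX₀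


/-- **stub 4 — `stub_mixedDeepBound`: mixed class, deep branch, `r ≤ 2(p+q)`** (OPEN; the lead's
"(iii) mixed classes below the G-cut").
Mixed compression class `∇T a b = G₀ (H₁ a b)ᵀ + (G₁ a b) H₀ᵀ` with constant `G₀ : N × p`,
`H₀ : N × q` of full column rank, `q ≥ 1`, corner of rank `r`, nonsingular somewhere, AND the DEEP
hypothesis: for every cut `c` above which `G₀` vanishes, `F` vanishes above `c` too (the
complementary VISIBLE case is settled by the landed relative H-constant lemma `hclR_relvis_bound`:
`r ≤ q`; the glue `bound_noCore` performs this dichotomy, so the stub only ever meets deep frames).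
Conclusion `r ≤ 2(p+q)` — the weakest form the assembly needs; conjectured truth `(2p − 1) + q`
(class inequality of card compression-normal-form; `(p,q) = (1,1)`: census of 266 552 coordinate
shadows + smoothings, `r = 3`, `N ≤ 16`: none (triage r1-1, kit j018292), `r = 2` attained by the
honest-Toeplitz PoC `(2,4)`).
Why plausibly true: above the cut only the H-part acts (relative Nakayama: at most `q` visible
target directions, PROVED as `hclR_relvis_bound`); below it the configuration is a left-constant
pencil with `p` stripes perturbed by a right-constant part whose top rows annihilate `E`
(`[T^H a b]_{<c} E = 0`), so the expected price is stub 3's plus `q`.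
Why it might fail: an interaction between the H-part and the stripes below the cut buying more than
one direction per right generator — no mechanism or example known; `p = 0` is vacuous (then the deep
hypothesis forces `F = 0`, so `r = 0`).  Size: L / open (likely FOLLOWS the method that settles
stub 3 rather than preceding it). -/
theorem stub_mixedDeepBound :
    ∀ (r N p q : ℕ) (T : Fin r → Fin r → Matrix (Fin N) (Fin N) ℂ) (E F : Matrix (Fin N) (Fin r) ℂ)
    (G₀ : Matrix (Fin N) (Fin p) ℂ) (H₀ : Matrix (Fin N) (Fin q) ℂ)
    (H₁ : Fin r → Fin r → Matrix (Fin N) (Fin p) ℂ) (G₁ : Fin r → Fin r → Matrix (Fin N) (Fin q) ℂ),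
    0 < q → E.rank = r → F.rank = r → G₀.rank = p → H₀.rank = q →
    (∀ X : Matrix (Fin r) (Fin r) ℂ, (∑ a : Fin r, ∑ b : Fin r, X a b • T a b) * E = F * X) →
    (∀ a b, T a b - (Matrix.of fun i j : Fin N => if (i : ℕ) = (j : ℕ) + 1 then (1 : ℂ) else 0) * T a b * (Matrix.of fun i j : Fin N => if (i : ℕ) = (j : ℕ) + 1 then (1 : ℂ) else 0)ᵀ = G₀ * (H₁ a b)ᵀ + G₁ a b * H₀ᵀ) →
    (∃ X₀ : Matrix (Fin r) (Fin r) ℂ, (∑ a : Fin r, ∑ b : Fin r, X₀ a b • T a b).det ≠ 0) →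
    (∀ c : ℕ, (∀ i : Fin N, (i : ℕ) < c → ∀ k : Fin p, G₀ i k = 0) →
      ∀ (a : Fin r) (i : Fin N), (i : ℕ) < c → F i a = 0) →
    r ≤ 2 * (p + q) := by
  sorry

/-- **stub 5 — `stub_coreClassBound`: classes with a primitive core, `r ≤ 2(p+q+ρ)`** (OPEN for
`ρ ≥ 4`; finite-type per `ρ` thanks to Atkinson's bound — this is where the card's lever bites).
Core-split form `∇T a b = G₀ (H₁ a b)ᵀ + (G₁ a b) H₀ᵀ + Γ (C a b) Θᵀ` with a NON-EMPTY core window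
(`m₀, n₀ ≥ 1`; in truth a primitive core has `ρ ≥ 2`, `m₀, n₀ ≥ 3`), `2m₀, 2n₀ ≤ ρ(ρ+1)`,
`rank C(X) ≤ ρ` for all `X`, `[G₀ | Γ]` and `[H₀ | Θ]` of full column rank, corner of rank `r`,
nonsingular somewhere, deep branch w.r.t. the combined left factor `[G₀ | Γ]` (the visible branch is
again `r ≤ q` by `hclR_relvis_bound`, performed in the glue `bound_core`).  Conclusion
`r ≤ 2(p+q+ρ)`.
Why plausibly true: the core term is SIMULTANEOUSLY left- and right-constant.  For `p = 0` the whole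
displacement is right-constant with `q + n₀` generators, so the landed H-constant lemma
`hclR_hconst_bound` gives `r ≤ q + n₀ ≤ q + ρ(ρ+1)/2`, which is `≤ 2(q + ρ)` for `ρ ≤ 3`: PROVABLE
NOW in that range (`ρ = 2`: the only primitive core is `S(φ₃)`, 3 × 3 alternating, dSP Thm 1
equality case; `ρ = 3`: cores between `4 × 4` and `6 × 6`).  The open part is `p ≥ 1` (left border
rows meeting a core: stub 3's stripes plus `≤ n₀` right-constant core generators) and `ρ ≥ 4`, where
the rank budget `rank C(X) ≤ ρ` must be used (RANK-AWARE pricing, the triage sharpening: counting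
generators alone gives `ρ(ρ+1)`, quadratic in `d`).
Why it might fail: a large primitive core (`ρ ≥ 4`, up to `10 × 10`) whose `n₀ > 2ρ` right factors
each buy a target direction despite `rank C ≤ ρ` — no example known; primitive spaces of bounded
rank are classified only for `ρ ≤ 3` (Atkinson 1983, Eisenbud–Harris 1988).  Size: L / open
(the `p = 0, ρ ≤ 3` sub-case is an afternoon from `hclR_hconst_bound`). -/
theorem stub_coreClassBound :
    ∀ (r N p q ρ m₀ n₀ : ℕ) (T : Fin r → Fin r → Matrix (Fin N) (Fin N) ℂ) (E F : Matrix (Fin N) (Fin r) ℂ)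
    (G₀ : Matrix (Fin N) (Fin p) ℂ) (H₀ : Matrix (Fin N) (Fin q) ℂ)
    (Γ : Matrix (Fin N) (Fin m₀) ℂ) (Θ : Matrix (Fin N) (Fin n₀) ℂ)
    (H₁ : Fin r → Fin r → Matrix (Fin N) (Fin p) ℂ) (G₁ : Fin r → Fin r → Matrix (Fin N) (Fin q) ℂ)
    (C : Fin r → Fin r → Matrix (Fin m₀) (Fin n₀) ℂ),
    0 < m₀ → 0 < n₀ → 2 * m₀ ≤ ρ * (ρ + 1) → 2 * n₀ ≤ ρ * (ρ + 1) →
    E.rank = r → F.rank = r →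
    (Matrix.fromCols G₀ Γ).rank = p + m₀ → (Matrix.fromCols H₀ Θ).rank = q + n₀ →
    (∀ X : Matrix (Fin r) (Fin r) ℂ, (∑ a : Fin r, ∑ b : Fin r, X a b • C a b).rank ≤ ρ) →
    (∀ X : Matrix (Fin r) (Fin r) ℂ, (∑ a : Fin r, ∑ b : Fin r, X a b • T a b) * E = F * X) →
    (∀ a b, T a b - (Matrix.of fun i j : Fin N => if (i : ℕ) = (j : ℕ) + 1 then (1 : ℂ) else 0) * T a b * (Matrix.of fun i j : Fin N => if (i : ℕ) = (j : ℕ) + 1 then (1 : ℂ) else 0)ᵀ = G₀ * (H₁ a b)ᵀ + G₁ a b * H₀ᵀ + Γ * C a b * Θᵀ) →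
    (∃ X₀ : Matrix (Fin r) (Fin r) ℂ, (∑ a : Fin r, ∑ b : Fin r, X₀ a b • T a b).det ≠ 0) →
    (∀ c : ℕ, (∀ i : Fin N, (i : ℕ) < c → (∀ k : Fin p, G₀ i k = 0) ∧ (∀ k : Fin m₀, Γ i k = 0)) →
      ∀ (a : Fin r) (i : Fin N), (i : ℕ) < c → F i a = 0) →
    r ≤ 2 * (p + q + ρ) := by
  sorry

/-! ## Glue (sorry-free) -/

/-- No-core classes: the visible/deep dichotomy.  A target entry of `F` above a cut above which `G₀`
vanishes gives `r ≤ q` by the landed relative H-constant lemma `hclR_relvis_bound`; otherwise the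
frame is deep and stub 3 (`q = 0`: the right-constant term is empty) or stub 4 (`q ≥ 1`) applies. -/
theorem bound_noCore
    (h₃ : ∀ (r N p : ℕ) (T : Fin r → Fin r → Matrix (Fin N) (Fin N) ℂ) (E F : Matrix (Fin N) (Fin r) ℂ)
      (G₀ : Matrix (Fin N) (Fin p) ℂ) (H₁ : Fin r → Fin r → Matrix (Fin N) (Fin p) ℂ),
      E.rank = r → F.rank = r → G₀.rank = p →
      (∀ X : Matrix (Fin r) (Fin r) ℂ, (∑ a : Fin r, ∑ b : Fin r, X a b • T a b) * E = F * X) →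
      (∀ a b, T a b - (Matrix.of fun i j : Fin N => if (i : ℕ) = (j : ℕ) + 1 then (1 : ℂ) else 0) * T a b * (Matrix.of fun i j : Fin N => if (i : ℕ) = (j : ℕ) + 1 then (1 : ℂ) else 0)ᵀ = G₀ * (H₁ a b)ᵀ) →
      (∃ X₀ : Matrix (Fin r) (Fin r) ℂ, (∑ a : Fin r, ∑ b : Fin r, X₀ a b • T a b).det ≠ 0) →
      r ≤ 2 * p)
    (h₄ : ∀ (r N p q : ℕ) (T : Fin r → Fin r → Matrix (Fin N) (Fin N) ℂ) (E F : Matrix (Fin N) (Fin r) ℂ)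
      (G₀ : Matrix (Fin N) (Fin p) ℂ) (H₀ : Matrix (Fin N) (Fin q) ℂ)
      (H₁ : Fin r → Fin r → Matrix (Fin N) (Fin p) ℂ) (G₁ : Fin r → Fin r → Matrix (Fin N) (Fin q) ℂ),
      0 < q → E.rank = r → F.rank = r → G₀.rank = p → H₀.rank = q →
      (∀ X : Matrix (Fin r) (Fin r) ℂ, (∑ a : Fin r, ∑ b : Fin r, X a b • T a b) * E = F * X) →
      (∀ a b, T a b - (Matrix.of fun i j : Fin N => if (i : ℕ) = (j : ℕ) + 1 then (1 : ℂ) else 0) * T a b * (Matrix.of fun i j : Fin N => if (i : ℕ) = (j : ℕ) + 1 then (1 : ℂ) else 0)ᵀ = G₀ * (H₁ a b)ᵀ + G₁ a b * H₀ᵀ) →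
      (∃ X₀ : Matrix (Fin r) (Fin r) ℂ, (∑ a : Fin r, ∑ b : Fin r, X₀ a b • T a b).det ≠ 0) →
      (∀ c : ℕ, (∀ i : Fin N, (i : ℕ) < c → ∀ k : Fin p, G₀ i k = 0) →
        ∀ (a : Fin r) (i : Fin N), (i : ℕ) < c → F i a = 0) →
      r ≤ 2 * (p + q))
    (r N p q : ℕ) (T : Fin r → Fin r → Matrix (Fin N) (Fin N) ℂ) (E F : Matrix (Fin N) (Fin r) ℂ)
    (G₀ : Matrix (Fin N) (Fin p) ℂ) (H₀ : Matrix (Fin N) (Fin q) ℂ)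
    (H₁ : Fin r → Fin r → Matrix (Fin N) (Fin p) ℂ) (G₁ : Fin r → Fin r → Matrix (Fin N) (Fin q) ℂ)
    (hE : E.rank = r) (hF : F.rank = r) (hG₀ : G₀.rank = p) (hH₀ : H₀.rank = q)
    (hcorner : (∀ X : Matrix (Fin r) (Fin r) ℂ, (∑ a : Fin r, ∑ b : Fin r, X a b • T a b) * E = F * X))
    (hdsp : ∀ a b, T a b - (Matrix.of fun i j : Fin N => if (i : ℕ) = (j : ℕ) + 1 then (1 : ℂ) else 0) * T a b * (Matrix.of fun i j : Fin N => if (i : ℕ) = (j : ℕ) + 1 then (1 : ℂ) else 0)ᵀ = G₀ * (H₁ a b)ᵀ + G₁ a b * H₀ᵀ)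
    (hns : (∃ X₀ : Matrix (Fin r) (Fin r) ℂ, (∑ a : Fin r, ∑ b : Fin r, X₀ a b • T a b).det ≠ 0)) :
    r ≤ 2 * (p + q) := by
  by_cases hvis : ∃ c : ℕ, (∀ i : Fin N, (i : ℕ) < c → ∀ k : Fin p, G₀ i k = 0) ∧
      ∃ (a : Fin r) (i : Fin N), (i : ℕ) < c ∧ F i a ≠ 0
  · obtain ⟨c, hGc, hv⟩ := hvis
    have h := hclR_relvis_bound r N p q c T E F G₀ H₀ H₁ G₁ hGc hv hcorner hdsp
    omega
  · push Not at hvis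
    rcases Nat.eq_zero_or_pos q with hq | hq
    · subst hq
      have hdsp' : ∀ a b, T a b - (Matrix.of fun i j : Fin N => if (i : ℕ) = (j : ℕ) + 1 then (1 : ℂ) else 0) * T a b * (Matrix.of fun i j : Fin N => if (i : ℕ) = (j : ℕ) + 1 then (1 : ℂ) else 0)ᵀ = G₀ * (H₁ a b)ᵀ := by
        intro a b
        have hzero : G₁ a b * H₀ᵀ = 0 := by
          ext i j
          simp [Matrix.mul_apply]
        rw [hdsp a b, hzero, add_zero]
      have h := h₃ r N p T E F G₀ H₁ hE hF hG₀ hcorner hdsp' hns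
      omega
    · have h := h₄ r N p q T E F G₀ H₀ H₁ G₁ hq hE hF hG₀ hH₀ hcorner hdsp hns hvis
      omega

/-- Core classes: the same dichotomy with the core term absorbed into the LEFT factor
`[G₀ | Γ] : N × (p + m₀)` (`Γ (C a b) Θᵀ = Γ (Θ (C a b)ᵀ)ᵀ`), so that the landed
`hclR_relvis_bound` settles the visible branch (`r ≤ q`); the deep branch is stub 5. -/
theorem bound_core
    (h₅ : ∀ (r N p q ρ m₀ n₀ : ℕ) (T : Fin r → Fin r → Matrix (Fin N) (Fin N) ℂ) (E F : Matrix (Fin N) (Fin r) ℂ)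
      (G₀ : Matrix (Fin N) (Fin p) ℂ) (H₀ : Matrix (Fin N) (Fin q) ℂ)
      (Γ : Matrix (Fin N) (Fin m₀) ℂ) (Θ : Matrix (Fin N) (Fin n₀) ℂ)
      (H₁ : Fin r → Fin r → Matrix (Fin N) (Fin p) ℂ) (G₁ : Fin r → Fin r → Matrix (Fin N) (Fin q) ℂ)
      (C : Fin r → Fin r → Matrix (Fin m₀) (Fin n₀) ℂ),
      0 < m₀ → 0 < n₀ → 2 * m₀ ≤ ρ * (ρ + 1) → 2 * n₀ ≤ ρ * (ρ + 1) →
      E.rank = r → F.rank = r →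
      (Matrix.fromCols G₀ Γ).rank = p + m₀ → (Matrix.fromCols H₀ Θ).rank = q + n₀ →
      (∀ X : Matrix (Fin r) (Fin r) ℂ, (∑ a : Fin r, ∑ b : Fin r, X a b • C a b).rank ≤ ρ) →
      (∀ X : Matrix (Fin r) (Fin r) ℂ, (∑ a : Fin r, ∑ b : Fin r, X a b • T a b) * E = F * X) →
      (∀ a b, T a b - (Matrix.of fun i j : Fin N => if (i : ℕ) = (j : ℕ) + 1 then (1 : ℂ) else 0) * T a b * (Matrix.of fun i j : Fin N => if (i : ℕ) = (j : ℕ) + 1 then (1 : ℂ) else 0)ᵀ = G₀ * (H₁ a b)ᵀ + G₁ a b * H₀ᵀ + Γ * C a b * Θᵀ) →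
      (∃ X₀ : Matrix (Fin r) (Fin r) ℂ, (∑ a : Fin r, ∑ b : Fin r, X₀ a b • T a b).det ≠ 0) →
      (∀ c : ℕ, (∀ i : Fin N, (i : ℕ) < c → (∀ k : Fin p, G₀ i k = 0) ∧ (∀ k : Fin m₀, Γ i k = 0)) →
        ∀ (a : Fin r) (i : Fin N), (i : ℕ) < c → F i a = 0) →
      r ≤ 2 * (p + q + ρ))
    (r N p q ρ m₀ n₀ : ℕ) (T : Fin r → Fin r → Matrix (Fin N) (Fin N) ℂ) (E F : Matrix (Fin N) (Fin r) ℂ)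
    (G₀ : Matrix (Fin N) (Fin p) ℂ) (H₀ : Matrix (Fin N) (Fin q) ℂ)
    (Γ : Matrix (Fin N) (Fin m₀) ℂ) (Θ : Matrix (Fin N) (Fin n₀) ℂ)
    (H₁ : Fin r → Fin r → Matrix (Fin N) (Fin p) ℂ) (G₁ : Fin r → Fin r → Matrix (Fin N) (Fin q) ℂ)
    (C : Fin r → Fin r → Matrix (Fin m₀) (Fin n₀) ℂ)
    (hm : 0 < m₀) (hn : 0 < n₀) (hm₀ : 2 * m₀ ≤ ρ * (ρ + 1)) (hn₀ : 2 * n₀ ≤ ρ * (ρ + 1))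
    (hE : E.rank = r) (hF : F.rank = r)
    (hGΓ : (Matrix.fromCols G₀ Γ).rank = p + m₀) (hHΘ : (Matrix.fromCols H₀ Θ).rank = q + n₀)
    (hrkC : ∀ X : Matrix (Fin r) (Fin r) ℂ, (∑ a : Fin r, ∑ b : Fin r, X a b • C a b).rank ≤ ρ)
    (hcorner : (∀ X : Matrix (Fin r) (Fin r) ℂ, (∑ a : Fin r, ∑ b : Fin r, X a b • T a b) * E = F * X))
    (hdsp : ∀ a b, T a b - (Matrix.of fun i j : Fin N => if (i : ℕ) = (j : ℕ) + 1 then (1 : ℂ) else 0) * T a b * (Matrix.of fun i j : Fin N => if (i : ℕ) = (j : ℕ) + 1 then (1 : ℂ) else 0)ᵀ = G₀ * (H₁ a b)ᵀ + G₁ a b * H₀ᵀ + Γ * C a b * Θᵀ)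
    (hns : (∃ X₀ : Matrix (Fin r) (Fin r) ℂ, (∑ a : Fin r, ∑ b : Fin r, X₀ a b • T a b).det ≠ 0)) :
    r ≤ 2 * (p + q + ρ) := by
  by_cases hvis : ∃ c : ℕ, (∀ i : Fin N, (i : ℕ) < c → (∀ k : Fin p, G₀ i k = 0) ∧
      (∀ k : Fin m₀, Γ i k = 0)) ∧ ∃ (a : Fin r) (i : Fin N), (i : ℕ) < c ∧ F i a ≠ 0
  · obtain ⟨c, hGc, hv⟩ := hvis
    -- combined constant left factor and combined varying right factor, reindexed to `Fin (p + m₀)`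
    set G₀' : Matrix (Fin N) (Fin (p + m₀)) ℂ :=
      (Matrix.fromCols G₀ Γ).submatrix id finSumFinEquiv.symm with hG₀'
    set H₁' : Fin r → Fin r → Matrix (Fin N) (Fin (p + m₀)) ℂ := fun a b =>
      (Matrix.fromCols (H₁ a b) (Θ * (C a b)ᵀ)).submatrix id finSumFinEquiv.symm with hH₁'
    have hG' : ∀ i : Fin N, (i : ℕ) < c → ∀ k : Fin (p + m₀), G₀' i k = 0 := by
      intro i hi k
      rw [hG₀', Matrix.submatrix_apply]
      rcases hk : finSumFinEquiv.symm k with k₁ | k₂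
      · rw [Matrix.fromCols_apply_inl]; exact (hGc i hi).1 k₁
      · rw [Matrix.fromCols_apply_inr]; exact (hGc i hi).2 k₂
    have hmul : ∀ a b, G₀' * (H₁' a b)ᵀ = G₀ * (H₁ a b)ᵀ + Γ * C a b * Θᵀ := by
      intro a b
      rw [hG₀', hH₁', Matrix.transpose_submatrix, Matrix.submatrix_mul_equiv,
        Matrix.transpose_fromCols, Matrix.fromCols_mul_fromRows, Matrix.submatrix_id_id,
        Matrix.transpose_mul, Matrix.transpose_transpose, Matrix.mul_assoc]
    have hdsp' : ∀ a b, T a b - (Matrix.of fun i j : Fin N => if (i : ℕ) = (j : ℕ) + 1 then (1 : ℂ) else 0) * T a b * (Matrix.of fun i j : Fin N => if (i : ℕ) = (j : ℕ) + 1 then (1 : ℂ) else 0)ᵀ = G₀' * (H₁' a b)ᵀ + G₁ a b * H₀ᵀ := by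
      intro a b
      rw [hmul, hdsp a b]
      abel
    have h := hclR_relvis_bound r N (p + m₀) q c T E F G₀' H₀ H₁' G₁ hG' hv hcorner hdsp'
    omega
  · push Not at hvis
    exact h₅ r N p q ρ m₀ n₀ T E F G₀ H₀ Γ Θ H₁ G₁ C hm hn hm₀ hn₀ hE hF hGΓ hHΘ hrkC hcorner hdsp
      hns hvis

/-! ## Certificates (sorry-free): the crux implies each class stub

So, given the two reduction stubs, the skeleton is an equivalence `crux ⟺ stub₃ ∧ stub₄ ∧ stub₅`. -/

/-- Stein displacement is linear in the pencil variable. -/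
theorem stein_pencil (r N : ℕ) (T : Fin r → Fin r → Matrix (Fin N) (Fin N) ℂ) (X : Matrix (Fin r) (Fin r) ℂ) :
    (∑ a : Fin r, ∑ b : Fin r, X a b • T a b) - (Matrix.of fun i j : Fin N => if (i : ℕ) = (j : ℕ) + 1 then (1 : ℂ) else 0) * (∑ a : Fin r, ∑ b : Fin r, X a b • T a b) * (Matrix.of fun i j : Fin N => if (i : ℕ) = (j : ℕ) + 1 then (1 : ℂ) else 0)ᵀ =
      ∑ a : Fin r, ∑ b : Fin r, X a b • (T a b - (Matrix.of fun i j : Fin N => if (i : ℕ) = (j : ℕ) + 1 then (1 : ℂ) else 0) * T a b * (Matrix.of fun i j : Fin N => if (i : ℕ) = (j : ℕ) + 1 then (1 : ℂ) else 0)ᵀ) := by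
  simp only [smul_sub, Finset.sum_sub_distrib, Finset.mul_sum, Finset.sum_mul, Matrix.mul_smul,
    Matrix.smul_mul]

/-- Sub-additivity of matrix rank over `ℂ` (folklore; not in Mathlib under this name). -/
theorem rank_add_le {m n : Type*} [Fintype n] (A B : Matrix m n ℂ) :
    (A + B).rank ≤ A.rank + B.rank := by
  unfold Matrix.rank
  rw [Matrix.mulVecLin_add]
  exact (Submodule.finrank_mono (LinearMap.range_add_le _ _)).trans
    (Submodule.finrank_add_le_finrank_add_finrank _ _)

/-- Certificate: HCL-R ⟹ stub 3 (a left-constant pencil has displacement rank `≤ p`). -/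
theorem leftConstBound_of_hclR (hcrux : HiddenCornerLemmaR) :
    ∀ (r N p : ℕ) (T : Fin r → Fin r → Matrix (Fin N) (Fin N) ℂ) (E F : Matrix (Fin N) (Fin r) ℂ)
    (G₀ : Matrix (Fin N) (Fin p) ℂ) (H₁ : Fin r → Fin r → Matrix (Fin N) (Fin p) ℂ),
    E.rank = r → F.rank = r → G₀.rank = p →
    (∀ X : Matrix (Fin r) (Fin r) ℂ, (∑ a : Fin r, ∑ b : Fin r, X a b • T a b) * E = F * X) →
    (∀ a b, T a b - (Matrix.of fun i j : Fin N => if (i : ℕ) = (j : ℕ) + 1 then (1 : ℂ) else 0) * T a b * (Matrix.of fun i j : Fin N => if (i : ℕ) = (j : ℕ) + 1 then (1 : ℂ) else 0)ᵀ = G₀ * (H₁ a b)ᵀ) →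
    (∃ X₀ : Matrix (Fin r) (Fin r) ℂ, (∑ a : Fin r, ∑ b : Fin r, X₀ a b • T a b).det ≠ 0) →
    r ≤ 2 * p := by
  intro r N p T E F G₀ H₁ hE hF hG₀ hcorner hdsp hns
  have hrank : ∀ X : Matrix (Fin r) (Fin r) ℂ, ((∑ a : Fin r, ∑ b : Fin r, X a b • T a b) - (Matrix.of fun i j : Fin N => if (i : ℕ) = (j : ℕ) + 1 then (1 : ℂ) else 0) * (∑ a : Fin r, ∑ b : Fin r, X a b • T a b) * (Matrix.of fun i j : Fin N => if (i : ℕ) = (j : ℕ) + 1 then (1 : ℂ) else 0)ᵀ).rank ≤ p := by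
    intro X
    rw [stein_pencil]
    have hsum : (∑ a : Fin r, ∑ b : Fin r, X a b • (T a b - (Matrix.of fun i j : Fin N => if (i : ℕ) = (j : ℕ) + 1 then (1 : ℂ) else 0) * T a b * (Matrix.of fun i j : Fin N => if (i : ℕ) = (j : ℕ) + 1 then (1 : ℂ) else 0)ᵀ)) =
        G₀ * (∑ a : Fin r, ∑ b : Fin r, X a b • H₁ a b)ᵀ := by
      simp only [hdsp, Matrix.transpose_sum, Matrix.transpose_smul, Matrix.mul_sum, Matrix.mul_smul]
    rw [hsum]
    exact (Matrix.rank_mul_le_left _ _).trans hG₀.le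
  have h := hcrux r N p T E F hE hF hcorner hrank hns
  omega

/-- Certificate: HCL-R ⟹ stub 4 (a mixed pencil has displacement rank `≤ p + q`). -/
theorem mixedDeepBound_of_hclR (hcrux : HiddenCornerLemmaR) :
    ∀ (r N p q : ℕ) (T : Fin r → Fin r → Matrix (Fin N) (Fin N) ℂ) (E F : Matrix (Fin N) (Fin r) ℂ)
    (G₀ : Matrix (Fin N) (Fin p) ℂ) (H₀ : Matrix (Fin N) (Fin q) ℂ)
    (H₁ : Fin r → Fin r → Matrix (Fin N) (Fin p) ℂ) (G₁ : Fin r → Fin r → Matrix (Fin N) (Fin q) ℂ),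
    0 < q → E.rank = r → F.rank = r → G₀.rank = p → H₀.rank = q →
    (∀ X : Matrix (Fin r) (Fin r) ℂ, (∑ a : Fin r, ∑ b : Fin r, X a b • T a b) * E = F * X) →
    (∀ a b, T a b - (Matrix.of fun i j : Fin N => if (i : ℕ) = (j : ℕ) + 1 then (1 : ℂ) else 0) * T a b * (Matrix.of fun i j : Fin N => if (i : ℕ) = (j : ℕ) + 1 then (1 : ℂ) else 0)ᵀ = G₀ * (H₁ a b)ᵀ + G₁ a b * H₀ᵀ) →
    (∃ X₀ : Matrix (Fin r) (Fin r) ℂ, (∑ a : Fin r, ∑ b : Fin r, X₀ a b • T a b).det ≠ 0) →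
    (∀ c : ℕ, (∀ i : Fin N, (i : ℕ) < c → ∀ k : Fin p, G₀ i k = 0) →
      ∀ (a : Fin r) (i : Fin N), (i : ℕ) < c → F i a = 0) →
    r ≤ 2 * (p + q) := by
  intro r N p q T E F G₀ H₀ H₁ G₁ hq hE hF hG₀ hH₀ hcorner hdsp hns hdeep
  have hrank : ∀ X : Matrix (Fin r) (Fin r) ℂ, ((∑ a : Fin r, ∑ b : Fin r, X a b • T a b) - (Matrix.of fun i j : Fin N => if (i : ℕ) = (j : ℕ) + 1 then (1 : ℂ) else 0) * (∑ a : Fin r, ∑ b : Fin r, X a b • T a b) * (Matrix.of fun i j : Fin N => if (i : ℕ) = (j : ℕ) + 1 then (1 : ℂ) else 0)ᵀ).rank ≤ p + q := by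
    intro X
    rw [stein_pencil]
    have hsum : (∑ a : Fin r, ∑ b : Fin r, X a b • (T a b - (Matrix.of fun i j : Fin N => if (i : ℕ) = (j : ℕ) + 1 then (1 : ℂ) else 0) * T a b * (Matrix.of fun i j : Fin N => if (i : ℕ) = (j : ℕ) + 1 then (1 : ℂ) else 0)ᵀ)) =
        G₀ * (∑ a : Fin r, ∑ b : Fin r, X a b • H₁ a b)ᵀ +
          (∑ a : Fin r, ∑ b : Fin r, X a b • G₁ a b) * H₀ᵀ := by
      simp only [hdsp, smul_add, Finset.sum_add_distrib, Matrix.transpose_sum, Matrix.transpose_smul,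
        Matrix.mul_sum, Matrix.mul_smul, Matrix.sum_mul, Matrix.smul_mul]
    rw [hsum]
    refine (rank_add_le _ _).trans (Nat.add_le_add ?_ ?_)
    · exact (Matrix.rank_mul_le_left _ _).trans hG₀.le
    · refine (Matrix.rank_mul_le_right _ _).trans ?_
      rw [Matrix.rank_transpose]
      exact hH₀.le
  have h := hcrux r N (p + q) T E F hE hF hcorner hrank hns
  omega

/-- Certificate: HCL-R ⟹ stub 5 (a core-split pencil has displacement rank `≤ p + q + ρ`). -/
theorem coreClassBound_of_hclR (hcrux : HiddenCornerLemmaR) :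
    ∀ (r N p q ρ m₀ n₀ : ℕ) (T : Fin r → Fin r → Matrix (Fin N) (Fin N) ℂ) (E F : Matrix (Fin N) (Fin r) ℂ)
    (G₀ : Matrix (Fin N) (Fin p) ℂ) (H₀ : Matrix (Fin N) (Fin q) ℂ)
    (Γ : Matrix (Fin N) (Fin m₀) ℂ) (Θ : Matrix (Fin N) (Fin n₀) ℂ)
    (H₁ : Fin r → Fin r → Matrix (Fin N) (Fin p) ℂ) (G₁ : Fin r → Fin r → Matrix (Fin N) (Fin q) ℂ)
    (C : Fin r → Fin r → Matrix (Fin m₀) (Fin n₀) ℂ),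
    0 < m₀ → 0 < n₀ → 2 * m₀ ≤ ρ * (ρ + 1) → 2 * n₀ ≤ ρ * (ρ + 1) →
    E.rank = r → F.rank = r →
    (Matrix.fromCols G₀ Γ).rank = p + m₀ → (Matrix.fromCols H₀ Θ).rank = q + n₀ →
    (∀ X : Matrix (Fin r) (Fin r) ℂ, (∑ a : Fin r, ∑ b : Fin r, X a b • C a b).rank ≤ ρ) →
    (∀ X : Matrix (Fin r) (Fin r) ℂ, (∑ a : Fin r, ∑ b : Fin r, X a b • T a b) * E = F * X) →
    (∀ a b, T a b - (Matrix.of fun i j : Fin N => if (i : ℕ) = (j : ℕ) + 1 then (1 : ℂ) else 0) * T a b * (Matrix.of fun i j : Fin N => if (i : ℕ) = (j : ℕ) + 1 then (1 : ℂ) else 0)ᵀ = G₀ * (H₁ a b)ᵀ + G₁ a b * H₀ᵀ + Γ * C a b * Θᵀ) →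
    (∃ X₀ : Matrix (Fin r) (Fin r) ℂ, (∑ a : Fin r, ∑ b : Fin r, X₀ a b • T a b).det ≠ 0) →
    (∀ c : ℕ, (∀ i : Fin N, (i : ℕ) < c → (∀ k : Fin p, G₀ i k = 0) ∧ (∀ k : Fin m₀, Γ i k = 0)) →
      ∀ (a : Fin r) (i : Fin N), (i : ℕ) < c → F i a = 0) →
    r ≤ 2 * (p + q + ρ) := by
  intro r N p q ρ m₀ n₀ T E F G₀ H₀ Γ Θ H₁ G₁ C hm hn hm₀ hn₀ hE hF hGΓ hHΘ hrkC hcorner hdsp hns hdeep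
  have hG₀ : G₀.rank ≤ p := (Matrix.rank_le_width G₀).trans (by simp)
  have hH₀ : H₀.rank ≤ q := (Matrix.rank_le_width H₀).trans (by simp)
  have hrank : ∀ X : Matrix (Fin r) (Fin r) ℂ, ((∑ a : Fin r, ∑ b : Fin r, X a b • T a b) - (Matrix.of fun i j : Fin N => if (i : ℕ) = (j : ℕ) + 1 then (1 : ℂ) else 0) * (∑ a : Fin r, ∑ b : Fin r, X a b • T a b) * (Matrix.of fun i j : Fin N => if (i : ℕ) = (j : ℕ) + 1 then (1 : ℂ) else 0)ᵀ).rank ≤ p + q + ρ := by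
    intro X
    rw [stein_pencil]
    have hsum : (∑ a : Fin r, ∑ b : Fin r, X a b • (T a b - (Matrix.of fun i j : Fin N => if (i : ℕ) = (j : ℕ) + 1 then (1 : ℂ) else 0) * T a b * (Matrix.of fun i j : Fin N => if (i : ℕ) = (j : ℕ) + 1 then (1 : ℂ) else 0)ᵀ)) =
        G₀ * (∑ a : Fin r, ∑ b : Fin r, X a b • H₁ a b)ᵀ +
          (∑ a : Fin r, ∑ b : Fin r, X a b • G₁ a b) * H₀ᵀ +
          Γ * (∑ a : Fin r, ∑ b : Fin r, X a b • C a b) * Θᵀ := by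
      simp only [hdsp, smul_add, Finset.sum_add_distrib, Matrix.transpose_sum, Matrix.transpose_smul,
        Matrix.mul_sum, Matrix.mul_smul, Matrix.sum_mul, Matrix.smul_mul]
    rw [hsum]
    refine (rank_add_le _ _).trans (Nat.add_le_add ((rank_add_le _ _).trans
      (Nat.add_le_add ?_ ?_)) ?_)
    · exact (Matrix.rank_mul_le_left _ _).trans hG₀
    · refine (Matrix.rank_mul_le_right _ _).trans ?_
      rw [Matrix.rank_transpose]
      exact hH₀
    · exact ((Matrix.rank_mul_le_left _ _).trans (Matrix.rank_mul_le_right _ _)).trans (hrkC X)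
  have h := hcrux r N (p + q + ρ) T E F hE hF hcorner hrank hns
  omega

/-- Base case of the hardest stub, machine-checked: stub 3 HOLDS at `p = 1` (indeed `r ≤ 1`), by the
landed valuation lemma `hclR_gconst_d_one` (p106002). -/
theorem leftConstBound_p_one :
    ∀ (r N : ℕ) (T : Fin r → Fin r → Matrix (Fin N) (Fin N) ℂ) (E F : Matrix (Fin N) (Fin r) ℂ)
      (G₀ : Matrix (Fin N) (Fin 1) ℂ) (H₁ : Fin r → Fin r → Matrix (Fin N) (Fin 1) ℂ),
      E.rank = r → F.rank = r → G₀.rank = 1 →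
      (∀ X : Matrix (Fin r) (Fin r) ℂ, (∑ a : Fin r, ∑ b : Fin r, X a b • T a b) * E = F * X) →
      (∀ a b, T a b - (Matrix.of fun i j : Fin N => if (i : ℕ) = (j : ℕ) + 1 then (1 : ℂ) else 0) * T a b * (Matrix.of fun i j : Fin N => if (i : ℕ) = (j : ℕ) + 1 then (1 : ℂ) else 0)ᵀ = G₀ * (H₁ a b)ᵀ) →
      (∃ X₀ : Matrix (Fin r) (Fin r) ℂ, (∑ a : Fin r, ∑ b : Fin r, X₀ a b • T a b).det ≠ 0) →
      r ≤ 2 * 1 := by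
  intro r N T E F G₀ H₁ hE hF _hG₀ hcorner hdsp hns
  have hdisp' : ∀ a b, T a b - (Matrix.of fun i j : Fin N => if (i : ℕ) = (j : ℕ) + 1 then (1 : ℂ) else 0) * T a b * (Matrix.of fun i j : Fin N => if (i : ℕ) = (j : ℕ) + 1 then (1 : ℂ) else 0)ᵀ = Matrix.vecMulVec (fun i => G₀ i 0) (fun j => H₁ a b j 0) := by
    intro a b
    rw [hdsp a b]
    ext i j
    simp [Matrix.mul_apply, Matrix.vecMulVec_apply]
  have h := hclR_gconst_d_one r N T E F hE hF (fun i => G₀ i 0) (fun a b j => H₁ a b j 0) hdisp' hcorner hns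
  omega

/-- Partial discharge of stub 5, machine-checked: with NO left border rows (`p = 0`) and a core of
upper rank `ρ ≤ 3`, the displacement is right-constant with `q + n₀` generators
(`[G₁ a b | Γ C a b] · [H₀ | Θ]ᵀ`), the landed H-constant lemma `hclR_hconst_bound` (p104469) gives
`r ≤ q + n₀`, and Atkinson's bound `2 n₀ ≤ ρ(ρ+1) ≤ 4ρ` yields `r ≤ 2(q + ρ)`.  So the open part
of stub 5 is `p ≥ 1` or `ρ ≥ 4`. -/
theorem coreClassBound_p_zero_small (r N q ρ m₀ n₀ : ℕ) (T : Fin r → Fin r → Matrix (Fin N) (Fin N) ℂ)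
    (E F : Matrix (Fin N) (Fin r) ℂ) (G₀ : Matrix (Fin N) (Fin 0) ℂ) (H₀ : Matrix (Fin N) (Fin q) ℂ)
    (Γ : Matrix (Fin N) (Fin m₀) ℂ) (Θ : Matrix (Fin N) (Fin n₀) ℂ)
    (H₁ : Fin r → Fin r → Matrix (Fin N) (Fin 0) ℂ) (G₁ : Fin r → Fin r → Matrix (Fin N) (Fin q) ℂ)
    (C : Fin r → Fin r → Matrix (Fin m₀) (Fin n₀) ℂ)
    (hρ : ρ ≤ 3) (hn₀ : 2 * n₀ ≤ ρ * (ρ + 1)) (hF : F.rank = r)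
    (hcorner : (∀ X : Matrix (Fin r) (Fin r) ℂ, (∑ a : Fin r, ∑ b : Fin r, X a b • T a b) * E = F * X))
    (hdsp : ∀ a b, T a b - (Matrix.of fun i j : Fin N => if (i : ℕ) = (j : ℕ) + 1 then (1 : ℂ) else 0) * T a b * (Matrix.of fun i j : Fin N => if (i : ℕ) = (j : ℕ) + 1 then (1 : ℂ) else 0)ᵀ = G₀ * (H₁ a b)ᵀ + G₁ a b * H₀ᵀ + Γ * C a b * Θᵀ) :
    r ≤ 2 * (q + ρ) := by
  rcases Nat.eq_zero_or_pos r with hr | hr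
  · omega
  have hFne : F ≠ 0 := by
    rintro rfl
    rw [Matrix.rank_zero] at hF
    omega
  set H₀' : Matrix (Fin N) (Fin (q + n₀)) ℂ :=
    (Matrix.fromCols H₀ Θ).submatrix id finSumFinEquiv.symm with hH₀'
  set G' : Fin r → Fin r → Matrix (Fin N) (Fin (q + n₀)) ℂ := fun a b =>
    (Matrix.fromCols (G₁ a b) (Γ * C a b)).submatrix id finSumFinEquiv.symm with hG'
  have hdsp' : ∀ a b, T a b - (Matrix.of fun i j : Fin N => if (i : ℕ) = (j : ℕ) + 1 then (1 : ℂ) else 0) * T a b * (Matrix.of fun i j : Fin N => if (i : ℕ) = (j : ℕ) + 1 then (1 : ℂ) else 0)ᵀ = G' a b * H₀'ᵀ := by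
    intro a b
    have h0 : G₀ * (H₁ a b)ᵀ = 0 := by
      ext i j
      simp [Matrix.mul_apply]
    rw [hdsp a b, h0, zero_add, hG', hH₀', Matrix.transpose_submatrix, Matrix.submatrix_mul_equiv,
      Matrix.transpose_fromCols, Matrix.fromCols_mul_fromRows, Matrix.submatrix_id_id, Matrix.mul_assoc]
  have h := hclR_hconst_bound r N (q + n₀) T E F H₀' G' hFne hcorner hdsp'
  interval_cases ρ <;> omega


/-- **Sorry-free composition** `of_parts : stub₁-statement → (stub₁ → stub₂)-statement → stub₃-statement →
stub₄-statement → stub₅-statement → (crux, unfolded verbatim)`: obtain the core-split form of the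
given pencil (stubs 1–2); an empty core window (`m₀ = 0 ∨ n₀ = 0`) kills the core term and
`bound_noCore` gives `r ≤ 2(p+q) ≤ 2d`; otherwise `bound_core` gives `r ≤ 2(p+q+ρ) ≤ 2d`.
(The conclusion is the crux's body written out, so that `HiddenCornerLemmaR_of` below is the
file's ONLY declaration concluding the route decl by name — the A12 audit analyses that one.) -/
theorem of_parts
    (h₁ : ∀ (m n d : ℕ) (V : Submodule ℂ (Matrix (Fin m) (Fin n) ℂ)), (∀ M ∈ V, M.rank ≤ d) →
      ∃ (P : Matrix (Fin m) (Fin m) ℂ) (Q : Matrix (Fin n) (Fin n) ℂ), IsUnit P ∧ IsUnit Q ∧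
        ∃ (BR CR : Finset (Fin m)) (BC CC : Finset (Fin n)) (ρ : ℕ),
          Disjoint BR CR ∧ Disjoint BC CC ∧ BR.card + BC.card + ρ ≤ d ∧
          2 * CR.card ≤ ρ * (ρ + 1) ∧ 2 * CC.card ≤ ρ * (ρ + 1) ∧
          (∀ M ∈ V, ∀ (i : Fin m) (j : Fin n), (P * M * Q) i j ≠ 0 →
            i ∈ BR ∨ j ∈ BC ∨ (i ∈ CR ∧ j ∈ CC)) ∧
          (∀ M ∈ V, (Matrix.of fun (i : Fin m) (j : Fin n) =>
            if i ∈ BR ∨ j ∈ BC then (0 : ℂ) else (P * M * Q) i j).rank ≤ ρ))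
    (h₂ : (∀ (m n d : ℕ) (V : Submodule ℂ (Matrix (Fin m) (Fin n) ℂ)), (∀ M ∈ V, M.rank ≤ d) →
        ∃ (P : Matrix (Fin m) (Fin m) ℂ) (Q : Matrix (Fin n) (Fin n) ℂ), IsUnit P ∧ IsUnit Q ∧
          ∃ (BR CR : Finset (Fin m)) (BC CC : Finset (Fin n)) (ρ : ℕ),
            Disjoint BR CR ∧ Disjoint BC CC ∧ BR.card + BC.card + ρ ≤ d ∧
            2 * CR.card ≤ ρ * (ρ + 1) ∧ 2 * CC.card ≤ ρ * (ρ + 1) ∧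
            (∀ M ∈ V, ∀ (i : Fin m) (j : Fin n), (P * M * Q) i j ≠ 0 →
              i ∈ BR ∨ j ∈ BC ∨ (i ∈ CR ∧ j ∈ CC)) ∧
            (∀ M ∈ V, (Matrix.of fun (i : Fin m) (j : Fin n) =>
              if i ∈ BR ∨ j ∈ BC then (0 : ℂ) else (P * M * Q) i j).rank ≤ ρ)) →
      ∀ (r N d : ℕ) (T : Fin r → Fin r → Matrix (Fin N) (Fin N) ℂ),
      (∀ X : Matrix (Fin r) (Fin r) ℂ, ((∑ a : Fin r, ∑ b : Fin r, X a b • T a b) - (Matrix.of fun i j : Fin N => if (i : ℕ) = (j : ℕ) + 1 then (1 : ℂ) else 0) * (∑ a : Fin r, ∑ b : Fin r, X a b • T a b) * (Matrix.of fun i j : Fin N => if (i : ℕ) = (j : ℕ) + 1 then (1 : ℂ) else 0)ᵀ).rank ≤ d) →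
      ∃ (p q ρ m₀ n₀ : ℕ), p + q + ρ ≤ d ∧ 2 * m₀ ≤ ρ * (ρ + 1) ∧ 2 * n₀ ≤ ρ * (ρ + 1) ∧
        ∃ (G₀ : Matrix (Fin N) (Fin p) ℂ) (H₀ : Matrix (Fin N) (Fin q) ℂ)
          (Γ : Matrix (Fin N) (Fin m₀) ℂ) (Θ : Matrix (Fin N) (Fin n₀) ℂ)
          (H₁ : Fin r → Fin r → Matrix (Fin N) (Fin p) ℂ) (G₁ : Fin r → Fin r → Matrix (Fin N) (Fin q) ℂ)
          (C : Fin r → Fin r → Matrix (Fin m₀) (Fin n₀) ℂ),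
          G₀.rank = p ∧ H₀.rank = q ∧ (Matrix.fromCols G₀ Γ).rank = p + m₀ ∧
          (Matrix.fromCols H₀ Θ).rank = q + n₀ ∧
          (∀ X : Matrix (Fin r) (Fin r) ℂ, (∑ a : Fin r, ∑ b : Fin r, X a b • C a b).rank ≤ ρ) ∧
          (∀ a b, T a b - (Matrix.of fun i j : Fin N => if (i : ℕ) = (j : ℕ) + 1 then (1 : ℂ) else 0) * T a b * (Matrix.of fun i j : Fin N => if (i : ℕ) = (j : ℕ) + 1 then (1 : ℂ) else 0)ᵀ = G₀ * (H₁ a b)ᵀ + G₁ a b * H₀ᵀ + Γ * C a b * Θᵀ))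
    (h₃ : ∀ (r N p : ℕ) (T : Fin r → Fin r → Matrix (Fin N) (Fin N) ℂ) (E F : Matrix (Fin N) (Fin r) ℂ)
      (G₀ : Matrix (Fin N) (Fin p) ℂ) (H₁ : Fin r → Fin r → Matrix (Fin N) (Fin p) ℂ),
      E.rank = r → F.rank = r → G₀.rank = p →
      (∀ X : Matrix (Fin r) (Fin r) ℂ, (∑ a : Fin r, ∑ b : Fin r, X a b • T a b) * E = F * X) →
      (∀ a b, T a b - (Matrix.of fun i j : Fin N => if (i : ℕ) = (j : ℕ) + 1 then (1 : ℂ) else 0) * T a b * (Matrix.of fun i j : Fin N => if (i : ℕ) = (j : ℕ) + 1 then (1 : ℂ) else 0)ᵀ = G₀ * (H₁ a b)ᵀ) →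
      (∃ X₀ : Matrix (Fin r) (Fin r) ℂ, (∑ a : Fin r, ∑ b : Fin r, X₀ a b • T a b).det ≠ 0) →
      r ≤ 2 * p)
    (h₄ : ∀ (r N p q : ℕ) (T : Fin r → Fin r → Matrix (Fin N) (Fin N) ℂ) (E F : Matrix (Fin N) (Fin r) ℂ)
      (G₀ : Matrix (Fin N) (Fin p) ℂ) (H₀ : Matrix (Fin N) (Fin q) ℂ)
      (H₁ : Fin r → Fin r → Matrix (Fin N) (Fin p) ℂ) (G₁ : Fin r → Fin r → Matrix (Fin N) (Fin q) ℂ),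
      0 < q → E.rank = r → F.rank = r → G₀.rank = p → H₀.rank = q →
      (∀ X : Matrix (Fin r) (Fin r) ℂ, (∑ a : Fin r, ∑ b : Fin r, X a b • T a b) * E = F * X) →
      (∀ a b, T a b - (Matrix.of fun i j : Fin N => if (i : ℕ) = (j : ℕ) + 1 then (1 : ℂ) else 0) * T a b * (Matrix.of fun i j : Fin N => if (i : ℕ) = (j : ℕ) + 1 then (1 : ℂ) else 0)ᵀ = G₀ * (H₁ a b)ᵀ + G₁ a b * H₀ᵀ) →
      (∃ X₀ : Matrix (Fin r) (Fin r) ℂ, (∑ a : Fin r, ∑ b : Fin r, X₀ a b • T a b).det ≠ 0) →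
      (∀ c : ℕ, (∀ i : Fin N, (i : ℕ) < c → ∀ k : Fin p, G₀ i k = 0) →
        ∀ (a : Fin r) (i : Fin N), (i : ℕ) < c → F i a = 0) →
      r ≤ 2 * (p + q))
    (h₅ : ∀ (r N p q ρ m₀ n₀ : ℕ) (T : Fin r → Fin r → Matrix (Fin N) (Fin N) ℂ) (E F : Matrix (Fin N) (Fin r) ℂ)
      (G₀ : Matrix (Fin N) (Fin p) ℂ) (H₀ : Matrix (Fin N) (Fin q) ℂ)
      (Γ : Matrix (Fin N) (Fin m₀) ℂ) (Θ : Matrix (Fin N) (Fin n₀) ℂ)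
      (H₁ : Fin r → Fin r → Matrix (Fin N) (Fin p) ℂ) (G₁ : Fin r → Fin r → Matrix (Fin N) (Fin q) ℂ)
      (C : Fin r → Fin r → Matrix (Fin m₀) (Fin n₀) ℂ),
      0 < m₀ → 0 < n₀ → 2 * m₀ ≤ ρ * (ρ + 1) → 2 * n₀ ≤ ρ * (ρ + 1) →
      E.rank = r → F.rank = r →
      (Matrix.fromCols G₀ Γ).rank = p + m₀ → (Matrix.fromCols H₀ Θ).rank = q + n₀ →
      (∀ X : Matrix (Fin r) (Fin r) ℂ, (∑ a : Fin r, ∑ b : Fin r, X a b • C a b).rank ≤ ρ) →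
      (∀ X : Matrix (Fin r) (Fin r) ℂ, (∑ a : Fin r, ∑ b : Fin r, X a b • T a b) * E = F * X) →
      (∀ a b, T a b - (Matrix.of fun i j : Fin N => if (i : ℕ) = (j : ℕ) + 1 then (1 : ℂ) else 0) * T a b * (Matrix.of fun i j : Fin N => if (i : ℕ) = (j : ℕ) + 1 then (1 : ℂ) else 0)ᵀ = G₀ * (H₁ a b)ᵀ + G₁ a b * H₀ᵀ + Γ * C a b * Θᵀ) →
      (∃ X₀ : Matrix (Fin r) (Fin r) ℂ, (∑ a : Fin r, ∑ b : Fin r, X₀ a b • T a b).det ≠ 0) →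
      (∀ c : ℕ, (∀ i : Fin N, (i : ℕ) < c → (∀ k : Fin p, G₀ i k = 0) ∧ (∀ k : Fin m₀, Γ i k = 0)) →
        ∀ (a : Fin r) (i : Fin N), (i : ℕ) < c → F i a = 0) →
      r ≤ 2 * (p + q + ρ)) :
    ∀ (r N d : ℕ) (T : Fin r → Fin r → Matrix (Fin N) (Fin N) ℂ) (E F : Matrix (Fin N) (Fin r) ℂ), E.rank = r → F.rank = r →
      (∀ X : Matrix (Fin r) (Fin r) ℂ, (∑ a : Fin r, ∑ b : Fin r, X a b • T a b) * E = F * X) →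
      (∀ X : Matrix (Fin r) (Fin r) ℂ, ((∑ a : Fin r, ∑ b : Fin r, X a b • T a b) - (Matrix.of fun i j : Fin N => if (i : ℕ) = (j : ℕ) + 1 then (1 : ℂ) else 0) * (∑ a : Fin r, ∑ b : Fin r, X a b • T a b) * (Matrix.of fun i j : Fin N => if (i : ℕ) = (j : ℕ) + 1 then (1 : ℂ) else 0)ᵀ).rank ≤ d) →
      (∃ X₀ : Matrix (Fin r) (Fin r) ℂ, (∑ a : Fin r, ∑ b : Fin r, X₀ a b • T a b).det ≠ 0) →
      r ≤ 2 * d := by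
  intro r N d T E F hE hF hcorner hdisp hns
  obtain ⟨p, q, ρ, m₀, n₀, hbud, hm₀, hn₀, G₀, H₀, Γ, Θ, H₁, G₁, C, hG₀, hH₀, hGΓ, hHΘ, hrkC, hdsp⟩ :=
    h₂ h₁ r N d T hdisp
  by_cases hmn : 0 < m₀ ∧ 0 < n₀
  · have h := bound_core h₅ r N p q ρ m₀ n₀ T E F G₀ H₀ Γ Θ H₁ G₁ C hmn.1 hmn.2 hm₀ hn₀ hE hF hGΓ
      hHΘ hrkC hcorner hdsp hns
    omega
  · have hdsp' : ∀ a b, T a b - (Matrix.of fun i j : Fin N => if (i : ℕ) = (j : ℕ) + 1 then (1 : ℂ) else 0) * T a b * (Matrix.of fun i j : Fin N => if (i : ℕ) = (j : ℕ) + 1 then (1 : ℂ) else 0)ᵀ = G₀ * (H₁ a b)ᵀ + G₁ a b * H₀ᵀ := by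
      intro a b
      have hzero : Γ * C a b * Θᵀ = 0 := by
        rcases Nat.eq_zero_or_pos m₀ with hm | hm
        · subst hm
          ext i j
          simp [Matrix.mul_apply]
        · have hn : n₀ = 0 := by omega
          subst hn
          ext i j
          simp [Matrix.mul_apply]
      rw [hdsp a b, hzero, add_zero]
    have h := bound_noCore h₃ h₄ r N p q T E F G₀ H₀ H₁ G₁ hE hF hG₀ hH₀ hcorner hdsp' hns
    omega

/-- **Skeleton theorem — the crux BY NAME** from the five registered stubs through the sorry-free
composition `of_parts` (`sorry` occurs only inside the five `stub_*`). -/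
theorem HiddenCornerLemmaR_of : HiddenCornerLemmaR :=
  of_parts al_normalForm stub_coreSplit stub_leftConstBound stub_mixedDeepBound stub_coreClassBound

end Summit.MatrixMultiplication.MatrixMultiplication.Cruxes.HiddenCornerLemmaR.AtkinsonLloydCoreSplit
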